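import Summits.BirchSwinnertonDyer.BirchSwinnertonDyer.Theorems.ErratumRoadFiveSigmaEulerFactorFirstUnitCoeff
import Summits.BirchSwinnertonDyer.BirchSwinnertonDyer.Theorems.ClassRecordThreeLambdaMatchingTransferAlgebra
import Literature.NumberTheory.EllipticCurves.BigRepModuleDualShiftedEndomorphismCharIdealProofs
import HarnessLib

/-!
# ROAD B12 ∕ B12′ — the Σ-EULER-FACTOR lemma, PART 3: «ITS μ-INVARIANT IS ZERO» — `μ` and the exact
# first-unit index (`λ`) of the ALGEBRAIC local factor `det((1+T)^c · M − 1) ∈ ℤ_p⟦T⟧` of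
# [GreenbergVatsal2000] Prop. 2.4 in the matrix form of the tree (defn-ty1, p568667), read in `R₀⟦T⟧`
# (every prime `p`; THEOREMS ONLY, Theses-free)

Cell `bsd-stepL` (run/shared/lean/pub/bsd-stepL/), seat `bsd-stepL-bdp` (prover g25, 2026-08-27). `--supports
stmt-BirchSwinnertonDyer-19702 --as helper`. Sequel of PART 1 `ErratumRoadFiveSigmaEulerFactorBinomialModP.lean`
(p568622) and PART 2 `ErratumRoadFiveSigmaEulerFactorFirstUnitCoeff.lean` (p570269). Memo: HOME/proof/PROOF-BDP.md
§58.3 (a) (the ALGEBRAIC Σ-factor), §61.5 (this bridge).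

THE BRIDGE. The typer lane's `BigRepModuleDualShiftedEndomorphismCharIdealProofs.lean` (defn-ty1 g10, p568667)
proves [GreenbergVatsal2000] Prop. 2.4's characteristic-ideal computation for the dual of the local cohomology at
a finitely decomposed place in MATRIX form: `Ch((ker E)^∨) = (det N)` with `N = (1+T)^c · ᵗM − 1`
(`BigRepModule.finite_isTorsion_charIdeal_characterModule_ker_shiftedEndo`, hypothesis `det N ≠ 0`), and
`det N = (−1)ⁿ · charpolyRev(ᵗM)((1+T)^c)` (`BigRepModule.det_shiftedMatrix_eq_aeval_charpolyRev`). The printed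
proposition ends «Its μ-invariant is zero» — NOT in that file. Since `charpolyRev(ᵗM) ∈ ℤ_p[Y]` has constant
term `1`, PART 2's `firstUnitCoeffAt_aeval_binomialSeries_map` applies verbatim at `𝒪 = ℤ_p`: this file proves

* §8 `binomSeries_eq_binomialSeries` — the tree's two spellings of `(1+T)^c ∈ ℤ_p⟦T⟧` agree
  (`BigRepModule.binomSeries ℤ_[p] c`, Coates–Sujatha's Mahler image of `γ^c`, = Mathlib's
  `PowerSeries.binomialSeries ℤ_[p] c`); `coeff_zero_charpolyRev` (`charpolyRev M (0) = 1`); `charpolyRev_map`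
  (naturality `charpolyRev (M.map f) = (charpolyRev M).map f`, so `Q̄ = charpolyRev M̄`).
* §9 **`firstUnitCoeffAt_det_binomialSeries_smul_sub_one`**: for `M ∈ M_n(ℤ_p)` and `c = p^s·c′`, `c′ ∈ ℤ_p^×`,
  the image of `det((1+T)^c · M − 1)` in `R₀⟦T⟧` satisfies `FU(·, p^s · ord_{Y=1} charpolyRev(M̄))` — `μ = 0` and
  `λ = p^{v_p(c)} ·` (multiplicity of `1` as a root of `det(1 − Y·M̄) ∈ 𝔽_p[Y]`, i.e. of the eigenvalue `1` of the
  residual matrix) = GV's «`λ(𝒫_ℓ) = s_ℓ d_ℓ`» with `d_ℓ` identified; `exists_firstUnitCoeffAt_det_…` (`c ≠ 0`);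
  **`det_binomialSeries_smul_sub_one_ne_zero`** (`c ≠ 0 ⇒ det N ≠ 0` — the `hN` binder of defn-ty1's theorem is
  AUTOMATIC at a place where Frobenius has infinite image in `Γ`); `constantCoeff_det_binomialSeries_smul_sub_one`
  (value at the trivial character: `det N (0) = det(M − 1)`).
* §10 the same three statements in defn-ty1's exact spelling `N = binomSeries ℤ_[p] c • (toMatrix b b Lt).map C − 1`
  (`firstUnitCoeffAt_det_shiftedMatrix`, `det_shiftedMatrix_ne_zero`, `exists_firstUnitCoeffAt_det_shiftedMatrix`).

HONEST FRAMING: pure algebra (`ℤ_p⟦T⟧`, `R₀⟦T⟧`, matrices); nothing about Galois cohomology, Selmer groups or any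
curve is asserted; the arithmetic identification of `Lt` with `ℓ⁻¹·Frobenius` on a lattice (imc-p1's L5 steps
(S3)∕(S5), K2 support 20495) is NOT touched; nothing booked (T7); no item closes; no new definition.
References: [GreenbergVatsal2000] §2 Prop. 2.4 («The characteristic ideal … is generated by 𝓟_ℓ. Its μ-invariant
is zero.»; proof: «μ(𝒫_ℓ) = 0, λ(𝒫_ℓ) = s_ℓ d_ℓ»); [Washington1997] §7.1 Prop. 7.2; [CoatesSujatha2006Cyclotomic]
Lemma 3.3.4.
-/

set_option autoImplicit false
-- the problem directory `BirchSwinnertonDyer/BirchSwinnertonDyer` (single-conjunct summit) forces the duplicate segment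
set_option linter.dupNamespace false

noncomputable section

open scoped Classical

open PowerSeries Literature.NumberTheory.EllipticCurves
  Summit.BirchSwinnertonDyer.Rank1Residual.X11b.Halves
  Summit.BirchSwinnertonDyer.Rank1Residual.X1.KellerYinHalves

namespace Summit.BirchSwinnertonDyer.BirchSwinnertonDyer.Theorems.SigmaFactorFU

variable {p : ℕ} [Fact p.Prime]

/-! ### §8 Spellings: `binomSeries = binomialSeries` at `𝒪 = ℤ_p`; `charpolyRev(0) = 1`; naturality of `charpolyRev` -/

/-- The tree's two spellings of `(1+T)^c ∈ ℤ_p⟦T⟧` agree: `BigRepModule.binomSeries ℤ_[p] c` (coefficients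
`algebraMap ℤ_p ℤ_p (C(c,i))`) `=` Mathlib's `PowerSeries.binomialSeries ℤ_[p] c` (coefficients `C(c,i) • 1`).
[cite: CoatesSujatha2006Cyclotomic, Lemma 3.3.4 (§3.3 p. 37)] -/
theorem binomSeries_eq_binomialSeries (c : ℤ_[p]) :
    BigRepModule.binomSeries ℤ_[p] c = binomialSeries ℤ_[p] c := by
  ext i
  rw [BigRepModule.coeff_binomSeries, binomialSeries_coeff, smul_eq_mul, mul_one, Algebra.algebraMap_self,
    RingHom.id_apply]

/-- `charpolyRev M = det(1 − Y·M)` has constant term `1`. [folklore] -/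
theorem coeff_zero_charpolyRev {R : Type*} [CommRing R] {m : Type*} [Fintype m] [DecidableEq m]
    (M : Matrix m m R) : M.charpolyRev.coeff 0 = 1 := by
  rw [Polynomial.coeff_zero_eq_eval_zero, Matrix.eval_charpolyRev]

/-- **Naturality of the reversed characteristic polynomial**: `charpolyRev (M.map f) = (charpolyRev M).map f`
(so the reduction mod `p` of `charpolyRev M`, `M ∈ M_n(ℤ_p)`, is `charpolyRev M̄`). [folklore] -/
theorem charpolyRev_map {R S : Type*} [CommRing R] [CommRing S] (f : R →+* S) {m : Type*} [Fintype m]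
    [DecidableEq m] (M : Matrix m m R) : (M.map f).charpolyRev = M.charpolyRev.map f := by
  rw [Matrix.charpolyRev, Matrix.charpolyRev, ← Polynomial.coe_mapRingHom, RingHom.map_det]
  congr 1
  ext i j
  simp only [RingHom.mapMatrix_apply, Matrix.map_apply, Matrix.sub_apply, Matrix.smul_apply, Matrix.one_apply,
    smul_eq_mul, Polynomial.coe_mapRingHom, Polynomial.map_sub, Polynomial.map_mul, Polynomial.map_X,
    Polynomial.map_C]
  split_ifs <;> simp

/-- `(-1)^n` is a unit of `R₀⟦T⟧`. [folklore] -/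
theorem isUnit_neg_one_pow (n : ℕ) : IsUnit ((-1 : UnrSeries p) ^ n) :=
  (isUnit_one.neg).pow n

/-! ### §9 `det((1+T)^c · M − 1)`, `M ∈ M_n(ℤ_p)`: `μ = 0`, first unit coefficient at `p^{v_p(c)} · ord_{Y=1} charpolyRev(M̄)` -/

/-- `det((1+T)^c · M − 1) = (−1)ⁿ · charpolyRev(M)((1+T)^c)` in `ℤ_p⟦T⟧` (defn-ty1's generic
`Matrix.det_smul_map_sub_one_eq_aeval_charpolyRev` at `S = ℤ_p⟦T⟧`, `u = (1+T)^c`).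
[cite: GreenbergVatsal2000, Prop. 2.4 (arXiv p. 22: 𝓟_ℓ = P_ℓ(ℓ⁻¹γ_ℓ), P_ℓ(X) = det(1 − Frob_ℓ X))] -/
theorem det_binomialSeries_smul_sub_one_eq {n : ℕ} (M : Matrix (Fin n) (Fin n) ℤ_[p]) (c : ℤ_[p]) :
    (binomialSeries ℤ_[p] c • M.map (PowerSeries.C (R := ℤ_[p])) - 1).det =
      (-1) ^ n * Polynomial.aeval (binomialSeries ℤ_[p] c) M.charpolyRev := by
  have h := Literature.NumberTheory.EllipticCurves.Matrix.det_smul_map_sub_one_eq_aeval_charpolyRev M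
    (binomialSeries ℤ_[p] c)
  rwa [Fintype.card_fin] at h

/-- The image in `R₀⟦T⟧`: `(det((1+T)^c · M − 1)).map toUnr = (−1)ⁿ · (charpolyRev M)^{toUnr}(((1+T)^c)^{toUnr})`.
[cite: GreenbergVatsal2000, Prop. 2.4] -/
theorem map_toUnr_det_binomialSeries_smul_sub_one {n : ℕ} (M : Matrix (Fin n) (Fin n) ℤ_[p]) (c : ℤ_[p]) :
    ((binomialSeries ℤ_[p] c • M.map (PowerSeries.C (R := ℤ_[p])) - 1).det).map (toUnr p) =
      (-1) ^ n * Polynomial.aeval ((binomialSeries ℤ_[p] c).map (toUnr p)) (M.charpolyRev.map (toUnr p)) := by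
  rw [det_binomialSeries_smul_sub_one_eq, map_mul, map_pow, map_neg, map_one, map_aeval_eq]

/-- **[GreenbergVatsal2000] Prop. 2.4, last sentence, in the kernel: «Its μ-invariant is zero» — with the EXACT
λ.** For `M ∈ M_n(ℤ_p)` and `c = p^s · c′` with `c′ ∈ ℤ_p^×`, the local factor `det((1+T)^c · M − 1) ∈ ℤ_p⟦T⟧`,
read in `R₀⟦T⟧`, has `μ = 0` and its first unit coefficient at `p^s · ord_{Y=1} charpolyRev(M̄)`
(`M̄ = M mod p`; `ord_{Y=1}` = `Polynomial.rootMultiplicity 1`, the multiplicity of the eigenvalue `1` of `M̄`) —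
GV's «`μ(𝒫_ℓ) = 0` and `λ(𝒫_ℓ) = s_ℓ d_ℓ`» with `p^{s_ℓ}` = the number of primes above the place in the
`ℤ_p`-extension and `d_ℓ` = that multiplicity. Proof: PART 2's `firstUnitCoeffAt_aeval_binomialSeries_map` for
`Q = charpolyRev M` (`Q(0) = 1`), times the unit `(−1)ⁿ`.
[cite: GreenbergVatsal2000, Prop. 2.4 and proof (arXiv pp. 21–22: «Its μ-invariant is zero», «λ(𝒫_ℓ) = s_ℓ d_ℓ»)] -/
theorem firstUnitCoeffAt_det_binomialSeries_smul_sub_one {n : ℕ} (M : Matrix (Fin n) (Fin n) ℤ_[p]) (s : ℕ)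
    {c' : ℤ_[p]} (hc' : IsUnit c') :
    ‖((coeff (p ^ s * (M.map (PadicInt.toZMod (p := p))).charpolyRev.rootMultiplicity 1)
        (((binomialSeries ℤ_[p] ((p : ℤ_[p]) ^ s * c') • M.map (PowerSeries.C (R := ℤ_[p])) - 1).det).map
          (toUnr p)) : unrIntegers p) : ℂ_[p])‖ = 1 ∧
      ∀ i < p ^ s * (M.map (PadicInt.toZMod (p := p))).charpolyRev.rootMultiplicity 1,
        ‖((coeff i (((binomialSeries ℤ_[p] ((p : ℤ_[p]) ^ s * c') • M.map (PowerSeries.C (R := ℤ_[p])) -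
          1).det).map (toUnr p)) : unrIntegers p) : ℂ_[p])‖ < 1 := by
  rw [map_toUnr_det_binomialSeries_smul_sub_one, charpolyRev_map]
  exact LambdaMatching.firstUnitCoeffAt_unit_mul (isUnit_neg_one_pow n)
    (firstUnitCoeffAt_aeval_binomialSeries_map M.charpolyRev
      (map_toZMod_ne_zero_of_coeff_zero_eq_one (coeff_zero_charpolyRev M)) s hc')

/-- **`μ(det((1+T)^c · M − 1)) = 0` for every `c ∈ ℤ_p ∖ {0}`**: the local factor has a first unit coefficient.
[cite: GreenbergVatsal2000, Prop. 2.4 («Its μ-invariant is zero»)] -/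
theorem exists_firstUnitCoeffAt_det_binomialSeries_smul_sub_one {n : ℕ} (M : Matrix (Fin n) (Fin n) ℤ_[p])
    {c : ℤ_[p]} (hc : c ≠ 0) :
    ∃ m : ℕ, ‖((coeff m (((binomialSeries ℤ_[p] c • M.map (PowerSeries.C (R := ℤ_[p])) - 1).det).map
        (toUnr p)) : unrIntegers p) : ℂ_[p])‖ = 1 ∧
      ∀ i < m, ‖((coeff i (((binomialSeries ℤ_[p] c • M.map (PowerSeries.C (R := ℤ_[p])) - 1).det).map
        (toUnr p)) : unrIntegers p) : ℂ_[p])‖ < 1 := by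
  obtain ⟨s, c', hc', rfl⟩ := exists_eq_pow_mul_unit hc
  exact ⟨_, firstUnitCoeffAt_det_binomialSeries_smul_sub_one M s hc'⟩

/-- A series of `R₀⟦T⟧` with a coefficient of norm `1` is the image of a NON-ZERO series. [folklore] -/
theorem ne_zero_of_norm_coeff_map_toUnr_eq_one {F : PowerSeries ℤ_[p]} {m : ℕ}
    (h : ‖((coeff m (F.map (toUnr p)) : unrIntegers p) : ℂ_[p])‖ = 1) : F ≠ 0 := by
  rintro rfl
  rw [map_zero, map_zero, ZeroMemClass.coe_zero, norm_zero] at h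
  exact zero_ne_one h

/-- **`det((1+T)^c · M − 1) ≠ 0` whenever `c ≠ 0`** — the hypothesis `hN : N.det ≠ 0` of defn-ty1's
`BigRepModule.finite_isTorsion_charIdeal_characterModule_ker_shiftedEndo` is AUTOMATIC at a place whose
Frobenius has non-trivial (hence infinite) image `γ^c`, `c ≠ 0`, in `Γ ≅ ℤ_p` (a finitely decomposed place).
[cite: GreenbergVatsal2000, Prop. 2.4] -/
theorem det_binomialSeries_smul_sub_one_ne_zero {n : ℕ} (M : Matrix (Fin n) (Fin n) ℤ_[p]) {c : ℤ_[p]}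
    (hc : c ≠ 0) : (binomialSeries ℤ_[p] c • M.map (PowerSeries.C (R := ℤ_[p])) - 1).det ≠ 0 := by
  obtain ⟨m, hm, -⟩ := exists_firstUnitCoeffAt_det_binomialSeries_smul_sub_one M hc
  exact ne_zero_of_norm_coeff_map_toUnr_eq_one hm

/-- **The value at the trivial character**: `det((1+T)^c · M − 1)(0) = det(M − 1)` (the factor `P_ℓ(𝟙)`, a unit
iff `1` is not an eigenvalue of `M̄`). [cite: GreenbergVatsal2000, Prop. 2.4 (remark after (2.4))] -/
theorem constantCoeff_det_binomialSeries_smul_sub_one {n : ℕ} (M : Matrix (Fin n) (Fin n) ℤ_[p]) (c : ℤ_[p]) :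
    constantCoeff ((binomialSeries ℤ_[p] c • M.map (PowerSeries.C (R := ℤ_[p])) - 1).det) = (M - 1).det := by
  rw [RingHom.map_det]
  congr 1
  ext i j
  simp only [RingHom.mapMatrix_apply, Matrix.map_apply, Matrix.sub_apply, Matrix.smul_apply, Matrix.one_apply,
    smul_eq_mul, map_sub, map_mul, binomialSeries_constantCoeff, constantCoeff_C, one_mul]
  split_ifs <;> simp

/-! ### §10 The same in defn-ty1's spelling `N = binomSeries ℤ_[p] c • (toMatrix b b Lt).map C − 1` -/

/-- **«Its μ-invariant is zero», matrix-of-an-endomorphism form.** For a free `ℤ_p`-module `Y` with basis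
`b : Fin n`, an endomorphism `Lt` (the adjoint of `L` on the cofree `A`, in defn-ty1's setting) and `c = p^s c′`,
`c′ ∈ ℤ_p^×`: the generator `det N`, `N = (1+T)^c · ᵗM − 1`, `ᵗM = (toMatrix b b Lt).map C`, of
`Ch((ker E)^∨)` (p568667) has, read in `R₀⟦T⟧`, `μ = 0` and first unit coefficient at
`p^s · ord_{Y=1} charpolyRev((toMatrix b b Lt) mod p)`.
[cite: GreenbergVatsal2000, Prop. 2.4 and proof (arXiv pp. 21–22: «Its μ-invariant is zero», «λ(𝒫_ℓ) = s_ℓ d_ℓ»)] -/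
theorem firstUnitCoeffAt_det_shiftedMatrix {n : ℕ} {Y : Type} [AddCommGroup Y] [Module ℤ_[p] Y]
    (b : Module.Basis (Fin n) ℤ_[p] Y) (Lt : Y →ₗ[ℤ_[p]] Y) (s : ℕ) {c' : ℤ_[p]} (hc' : IsUnit c') :
    ‖((coeff (p ^ s * ((LinearMap.toMatrix b b Lt).map (PadicInt.toZMod (p := p))).charpolyRev.rootMultiplicity 1)
        (((BigRepModule.binomSeries ℤ_[p] ((p : ℤ_[p]) ^ s * c') •
          (LinearMap.toMatrix b b Lt).map (PowerSeries.C (R := ℤ_[p])) - 1).det).map (toUnr p)) :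
          unrIntegers p) : ℂ_[p])‖ = 1 ∧
      ∀ i < p ^ s * ((LinearMap.toMatrix b b Lt).map (PadicInt.toZMod (p := p))).charpolyRev.rootMultiplicity 1,
        ‖((coeff i (((BigRepModule.binomSeries ℤ_[p] ((p : ℤ_[p]) ^ s * c') •
          (LinearMap.toMatrix b b Lt).map (PowerSeries.C (R := ℤ_[p])) - 1).det).map (toUnr p)) :
          unrIntegers p) : ℂ_[p])‖ < 1 := by
  rw [binomSeries_eq_binomialSeries]
  exact firstUnitCoeffAt_det_binomialSeries_smul_sub_one (LinearMap.toMatrix b b Lt) s hc'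

/-- **`μ = 0` for `det N`, `c ≠ 0`** (defn-ty1's spelling). [cite: GreenbergVatsal2000, Prop. 2.4 («Its μ-invariant is zero»)] -/
theorem exists_firstUnitCoeffAt_det_shiftedMatrix {n : ℕ} {Y : Type} [AddCommGroup Y] [Module ℤ_[p] Y]
    (b : Module.Basis (Fin n) ℤ_[p] Y) (Lt : Y →ₗ[ℤ_[p]] Y) {c : ℤ_[p]} (hc : c ≠ 0) :
    ∃ m : ℕ, ‖((coeff m (((BigRepModule.binomSeries ℤ_[p] c •
        (LinearMap.toMatrix b b Lt).map (PowerSeries.C (R := ℤ_[p])) - 1).det).map (toUnr p)) :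
        unrIntegers p) : ℂ_[p])‖ = 1 ∧
      ∀ i < m, ‖((coeff i (((BigRepModule.binomSeries ℤ_[p] c •
        (LinearMap.toMatrix b b Lt).map (PowerSeries.C (R := ℤ_[p])) - 1).det).map (toUnr p)) :
        unrIntegers p) : ℂ_[p])‖ < 1 := by
  rw [binomSeries_eq_binomialSeries]
  exact exists_firstUnitCoeffAt_det_binomialSeries_smul_sub_one (LinearMap.toMatrix b b Lt) hc

/-- **`det N ≠ 0` for `c ≠ 0`** (defn-ty1's spelling): the `hN` binder of
`BigRepModule.finite_isTorsion_charIdeal_characterModule_ker_shiftedEndo` ∕ `det_mem_…` at `𝒪 = ℤ_p` holds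
at every place with `c ≠ 0`. [cite: GreenbergVatsal2000, Prop. 2.4] -/
theorem det_shiftedMatrix_ne_zero {n : ℕ} {Y : Type} [AddCommGroup Y] [Module ℤ_[p] Y]
    (b : Module.Basis (Fin n) ℤ_[p] Y) (Lt : Y →ₗ[ℤ_[p]] Y) {c : ℤ_[p]} (hc : c ≠ 0) :
    (BigRepModule.binomSeries ℤ_[p] c • (LinearMap.toMatrix b b Lt).map (PowerSeries.C (R := ℤ_[p])) - 1).det
      ≠ 0 := by
  rw [binomSeries_eq_binomialSeries]
  exact det_binomialSeries_smul_sub_one_ne_zero (LinearMap.toMatrix b b Lt) hc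

/-- **Value at the trivial character** (defn-ty1's spelling): `det N (0) = det(toMatrix b b Lt − 1)`.
[cite: GreenbergVatsal2000, Prop. 2.4 (remark after (2.4))] -/
theorem constantCoeff_det_shiftedMatrix {n : ℕ} {Y : Type} [AddCommGroup Y] [Module ℤ_[p] Y]
    (b : Module.Basis (Fin n) ℤ_[p] Y) (Lt : Y →ₗ[ℤ_[p]] Y) (c : ℤ_[p]) :
    constantCoeff ((BigRepModule.binomSeries ℤ_[p] c •
        (LinearMap.toMatrix b b Lt).map (PowerSeries.C (R := ℤ_[p])) - 1).det) =
      (LinearMap.toMatrix b b Lt - 1).det := by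
  rw [binomSeries_eq_binomialSeries]
  exact constantCoeff_det_binomialSeries_smul_sub_one (LinearMap.toMatrix b b Lt) c

/-! ### §11 (APPEND, bdp g25) The B-keyed generator `((charpoly Lt₀).reverse)((1+T)^c)` of defn-ty1's (G7) §5
(p573033: `charIdeal Λ (ker E_B)^∨ = (aeval (binomSeries ℤ_[p] c) (LinearMap.charpoly Lt₀).reverse)`, no basis ∕ det):
`μ = 0`, exact first-unit index, non-vanishing -/

/-- **`μ = 0` and the exact λ of `Q((1+T)^c)` in the `binomSeries` spelling**, for any `Q ∈ ℤ_p[Y]` with `Q(0) = 1`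
and `c = p^s · c′`, `c′ ∈ ℤ_p^×`: `FU((Q((1+T)^c)).map toUnr, p^s · ord_{Y=1} Q̄)`.
[cite: GreenbergVatsal2000, Prop. 2.4 («Its μ-invariant is zero», «λ(𝒫_ℓ) = s_ℓ d_ℓ»)] -/
theorem firstUnitCoeffAt_map_toUnr_aeval_binomSeries (Q : Polynomial ℤ_[p]) (hQ : Q.coeff 0 = 1) (s : ℕ)
    {c' : ℤ_[p]} (hc' : IsUnit c') :
    ‖((coeff (p ^ s * (Q.map (PadicInt.toZMod (p := p))).rootMultiplicity 1)
        ((Polynomial.aeval (BigRepModule.binomSeries ℤ_[p] ((p : ℤ_[p]) ^ s * c')) Q).map (toUnr p)) :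
        unrIntegers p) : ℂ_[p])‖ = 1 ∧
      ∀ i < p ^ s * (Q.map (PadicInt.toZMod (p := p))).rootMultiplicity 1,
        ‖((coeff i ((Polynomial.aeval (BigRepModule.binomSeries ℤ_[p] ((p : ℤ_[p]) ^ s * c')) Q).map (toUnr p)) :
          unrIntegers p) : ℂ_[p])‖ < 1 := by
  rw [binomSeries_eq_binomialSeries, map_aeval_eq]
  exact firstUnitCoeffAt_aeval_binomialSeries_map Q (map_toZMod_ne_zero_of_coeff_zero_eq_one hQ) s hc'

/-- **`μ(Q((1+T)^c)) = 0`** (`binomSeries` spelling) for `Q(0) = 1`, `c ≠ 0`. [cite: GreenbergVatsal2000, Prop. 2.4] -/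
theorem exists_firstUnitCoeffAt_map_toUnr_aeval_binomSeries (Q : Polynomial ℤ_[p]) (hQ : Q.coeff 0 = 1)
    {c : ℤ_[p]} (hc : c ≠ 0) :
    ∃ m : ℕ, ‖((coeff m ((Polynomial.aeval (BigRepModule.binomSeries ℤ_[p] c) Q).map (toUnr p)) :
        unrIntegers p) : ℂ_[p])‖ = 1 ∧
      ∀ i < m, ‖((coeff i ((Polynomial.aeval (BigRepModule.binomSeries ℤ_[p] c) Q).map (toUnr p)) :
        unrIntegers p) : ℂ_[p])‖ < 1 := by
  obtain ⟨s, c', hc', rfl⟩ := exists_eq_pow_mul_unit hc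
  exact ⟨_, firstUnitCoeffAt_map_toUnr_aeval_binomSeries Q hQ s hc'⟩

/-- **`Q((1+T)^c) ≠ 0` in `ℤ_p⟦T⟧`** (`binomSeries` spelling) for `Q(0) = 1`, `c ≠ 0`. [cite: GreenbergVatsal2000, Prop. 2.4] -/
theorem aeval_binomSeries_ne_zero (Q : Polynomial ℤ_[p]) (hQ : Q.coeff 0 = 1) {c : ℤ_[p]} (hc : c ≠ 0) :
    Polynomial.aeval (BigRepModule.binomSeries ℤ_[p] c) Q ≠ 0 := by
  obtain ⟨m, hm, -⟩ := exists_firstUnitCoeffAt_map_toUnr_aeval_binomSeries Q hQ hc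
  exact ne_zero_of_norm_coeff_map_toUnr_eq_one hm

/-- The reversed characteristic polynomial of an endomorphism of a finite free module has constant term `1`
(`charpoly` is monic). [folklore] -/
theorem coeff_zero_reverse_charpoly {R : Type*} [CommRing R] [Nontrivial R] {Y : Type*} [AddCommGroup Y]
    [Module R Y] [Module.Free R Y] [Module.Finite R Y] (L : Y →ₗ[R] Y) :
    (LinearMap.charpoly L).reverse.coeff 0 = 1 := by
  rw [Polynomial.coeff_zero_reverse, (LinearMap.charpoly_monic L).leadingCoeff]

/-- **[GreenbergVatsal2000] Prop. 2.4, last sentence, for defn-ty1's B-keyed generator** (p573033 §5: the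
characteristic ideal of `(ker E_B)^∨` is generated by `((charpoly Lt₀).reverse)((1+T)^c)` for ANY free dual lattice
with adjoint `Lt₀`): for `c = p^s · c′`, `c′ ∈ ℤ_p^×`, that generator read in `R₀⟦T⟧` has `μ = 0` and first unit
coefficient at `p^s · ord_{Y=1}` of `(charpoly Lt₀).reverse mod p` — «`λ(𝒫_ℓ) = s_ℓ d_ℓ`», `d_ℓ` = the multiplicity of
the eigenvalue `1` of `Lt₀ mod p`. [cite: GreenbergVatsal2000, Prop. 2.4 and proof (arXiv pp. 21–22)] -/
theorem firstUnitCoeffAt_map_toUnr_aeval_binomSeries_reverse_charpoly {Y : Type} [AddCommGroup Y] [Module ℤ_[p] Y]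
    [Module.Free ℤ_[p] Y] [Module.Finite ℤ_[p] Y] (Lt₀ : Y →ₗ[ℤ_[p]] Y) (s : ℕ) {c' : ℤ_[p]} (hc' : IsUnit c') :
    ‖((coeff (p ^ s * ((LinearMap.charpoly Lt₀).reverse.map (PadicInt.toZMod (p := p))).rootMultiplicity 1)
        ((Polynomial.aeval (BigRepModule.binomSeries ℤ_[p] ((p : ℤ_[p]) ^ s * c'))
          (LinearMap.charpoly Lt₀).reverse).map (toUnr p)) : unrIntegers p) : ℂ_[p])‖ = 1 ∧
      ∀ i < p ^ s * ((LinearMap.charpoly Lt₀).reverse.map (PadicInt.toZMod (p := p))).rootMultiplicity 1,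
        ‖((coeff i ((Polynomial.aeval (BigRepModule.binomSeries ℤ_[p] ((p : ℤ_[p]) ^ s * c'))
          (LinearMap.charpoly Lt₀).reverse).map (toUnr p)) : unrIntegers p) : ℂ_[p])‖ < 1 :=
  firstUnitCoeffAt_map_toUnr_aeval_binomSeries _ (coeff_zero_reverse_charpoly Lt₀) s hc'

/-- **`μ = 0` for the B-keyed generator, `c ≠ 0`.** [cite: GreenbergVatsal2000, Prop. 2.4 («Its μ-invariant is zero»)] -/
theorem exists_firstUnitCoeffAt_map_toUnr_aeval_binomSeries_reverse_charpoly {Y : Type} [AddCommGroup Y]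
    [Module ℤ_[p] Y] [Module.Free ℤ_[p] Y] [Module.Finite ℤ_[p] Y] (Lt₀ : Y →ₗ[ℤ_[p]] Y) {c : ℤ_[p]}
    (hc : c ≠ 0) :
    ∃ m : ℕ, ‖((coeff m ((Polynomial.aeval (BigRepModule.binomSeries ℤ_[p] c)
        (LinearMap.charpoly Lt₀).reverse).map (toUnr p)) : unrIntegers p) : ℂ_[p])‖ = 1 ∧
      ∀ i < m, ‖((coeff i ((Polynomial.aeval (BigRepModule.binomSeries ℤ_[p] c)
        (LinearMap.charpoly Lt₀).reverse).map (toUnr p)) : unrIntegers p) : ℂ_[p])‖ < 1 :=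
  exists_firstUnitCoeffAt_map_toUnr_aeval_binomSeries _ (coeff_zero_reverse_charpoly Lt₀) hc

/-- **The B-keyed generator is non-zero for `c ≠ 0`.** [cite: GreenbergVatsal2000, Prop. 2.4] -/
theorem aeval_binomSeries_reverse_charpoly_ne_zero {Y : Type} [AddCommGroup Y] [Module ℤ_[p] Y]
    [Module.Free ℤ_[p] Y] [Module.Finite ℤ_[p] Y] (Lt₀ : Y →ₗ[ℤ_[p]] Y) {c : ℤ_[p]} (hc : c ≠ 0) :
    Polynomial.aeval (BigRepModule.binomSeries ℤ_[p] c) (LinearMap.charpoly Lt₀).reverse ≠ 0 :=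
  aeval_binomSeries_ne_zero _ (coeff_zero_reverse_charpoly Lt₀) hc

end Summit.BirchSwinnertonDyer.BirchSwinnertonDyer.Theorems.SigmaFactorFU

end
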